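/-
Copyright: lit-balaban cell, reader/typer seat r01 (gen 44), B4 fold owner.  Released under Apache 2.0 license as described in the
file LICENSE.
-/
import Literature.MathematicalPhysics.QuantumFieldTheory.Balaban1983to89.B4TwoScaleForm

/-!
# `Balaban1983to89.B4Ineq228OperatorOrder` — [Balaban1983RegularityDecay] p. 580, **(2.28) AS AN OPERATOR-ORDER STATEMENT**:
# «0 < G_k(□,0) ≦ c₀I, c₀⁻¹ = min{π², a_k}, hence ‖G_k(□,0)f‖₂ ≦ c₀‖f‖₂» for □ = any finite union of unit cubes, A = 0

statement-level skeleton of published theorems with citation tags; proofs where landed; nothing here is a claim about the Yang–Mills mass gap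

CITATION HEADER.  T. Bałaban, *Regularity and decay of lattice Green's functions*, Commun. Math. Phys. **89** (1983) 571–597,
doi:10.1007/bf01214744 [Balaban1983RegularityDecay] (cell paper B4; held text `paper:balaban1983-cmp89-regularity-decay`, journal page =
PDF page + 570), p. 580 [PDF 10]; render `pub-balaban/b2b-balaban-ref1/pages/1983-cmp89-regularity-decay/1983-cmp89-regularity-decay-p010-x2.png`
read as an image by this seat (unit `lit-balaban-r01` gen 44, B4 fold owner; HOME `run/shared/lean/pub/lit-balaban/`; SKELETON row
**B4.Eq2.27** = displays (2.26bis)–(2.28) of the proof of Lemma 2.1, the one row of [B4] still headed `typed-existing` on 2026-08-23).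

WHAT IS PRINTED (p. 580, verbatim).  «Thus we have to prove the bounds (2.25). Using the same gauge transformation as in the proof of
Lemma 2.4, we reduce them to the case A₀ = 0. Now these bounds are consequences of quadratic form considerations. At first let us notice
that □ is a sum of unit cubes Δ and we have
  ⟨φ, (−Δ^{η,N}_□ + m_k² + a_kP_k)φ⟩ ≧ Σ_{Δ⊂□} ⟨φ, (−Δ^{η,N}_Δ + a_kP_k)φ⟩.   (2.26)
The operator −Δ^{η,N}_Δ is bounded from below by π² on a subspace of functions on Δ orthogonal to constant functions, which are its
eigenvectors corresponding to eigenvalue 0. The operator P_k is an orthogonal projection on a subspace of constant functions, thus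
  ⟨φ, (−Δ^{η,N}_Δ + a_kP_k)φ⟩ ≧ min{π², a_k}‖φ‖_{L²(Δ)},   (2.27)   [sic: ‖φ‖²_{L²(Δ)}]
and from this and (2.26) we get
  0 < G_k(□,0) ≦ c₀I,   c₀⁻¹ = min{π², a_k},   hence ‖G_k(□,0)f‖₂ ≦ c₀‖f‖₂.   (2.28)»
p. 572: (1.3) the Neumann form `Σ_{b⊂Ω} η^d|η⁻¹(φ(b₊) − φ(b₋))|²`, (1.4)–(1.5) `P_k = Q_k^*Q_k`, (1.6) `G_k(Ω,A) = (−Δ^η_A + m_k² + a_kP_k(A))⁻¹`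
with «m² ≥ 0 and a is a positive constant close to 1»; p. 573: «a_k is a constant proportional to a»; p. 587: «the recursive relation
a_{k+1} = aa_k/(aL⁻² + a_k)» (so a_k ≤ a).

THE LOCATED IMPRECISION (census G-B4-03 of `pub-balaban/GAPS.md`, kind `print`, harmless).  On the η-lattice (η = 1/s, s ≥ 2 sites per
direction) the Neumann gap of −Δ^{η,N}_Δ on the mean-free functions is `4η⁻²sin²(πη/2) ∈ [8, π²[`, never π² (`B4Block227Sharp.gap_eq`,
`eight_le_gap`, `gap_lt_pi_sq`; kernel witness that (2.27) with a_k = π² FAILS: `B4Block227Sharp.not_display227Printed_pi_sq`); so the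
SENTENCE before (2.27) holds in the continuum only.  The DISPLAYS (2.27)/(2.28) are nevertheless true exactly as printed in print's own
regime «a close to 1», a_k ≤ a ≤ 8: there `min{π², a_k} = min{8, a_k} = a_k` (`B4.display227_moot`; (2.27) as printed for a_k ≤ 8:
`B4Block227.display227Printed_blockForm`, sharp range `B4Block227Sharp.display227Printed_blockForm_iff`; for ALL a_k with the lattice
constant min{8, a_k}: `B4Block227.display227Repaired_blockForm`).  Downstream only c₀ = O(1) is used (Lemma 2.1; [B6] (2.11) consumes
(2.26)–(2.27) and is certified with 8, `B6Eq211`).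

WHAT THIS MODULE PROVES (kernel-checked; 2 definitions WITH BODIES (`green`, `unitCubes`) + 2 auxiliary definitions + theorems; 0 `sorry`;
0 `Prop` facts; axioms standard).  Model of record = `B4TwoScaleForm.CellData` (A = 0, lattice units: □ = `C.S` = a finite disjoint union of
cubic cells, the operator `H = C.opHBox s2 m2 = s2·(−Δ^N_□) + m² + Σ_cells w·1_cell⟨1_cell,·⟩` on the functions on □, gradient weight
`s2 = η⁻²`, which for unit cubes of the η-lattice with weight `a_k s^{−D}` IS print's `−Δ^{η,N}_□ + m_k² + a_kP_k` as an operator on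
functions (module docstring of `B4TwoScaleForm`, §Dictionary); `H` is a bijection for `m² + κ > 0`, `opHBox_bijective`):
* `green C hs m2 hκ hmk` — **THE GREEN OPERATOR `G_k(□,0) := H⁻¹`** as a `ℂ`-linear equivalence of the functions on □ (`opHBox_green`,
  `green_opHBox`, `green_unique`);
* `ipS_green_im` — `⟨f, G f⟩_□` is REAL (`G` Hermitian, so «0 < G ≦ c₀I» is a statement about real quadratic forms), `ipS_green_re`;
* **`green_form_lower`, `green_pos` — «0 < G_k(□,0)»**: `(m² + κ)·‖Gf‖²_□ ≤ ⟨f, Gf⟩_□` and `⟨f, Gf⟩_□ > 0` for `f ≠ 0`;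
* **`green_form_upper` — «G_k(□,0) ≦ c₀I»**: `⟨f, Gf⟩_□ ≤ (m² + κ)⁻¹·‖f‖²_□`;
* **`green_norm_bound` — «hence ‖G_k(□,0)f‖₂ ≦ c₀‖f‖₂»**: `‖Gf‖_□ ≤ (m² + κ)⁻¹·‖f‖_□` (the tree's `CellData.green_norm_le` re-read on `G`);
  here `κ` is any lower constant of the cell data (`CellData.IsLowerConst`: `κ ≤ min{8·s2/N², w·N^D}` per cell), so `c₀⁻¹ = m² + κ`;
* `unitCubes s hs Y a` — **print's □ = ⋃_{y∈Y} Δ_y**, the unit cubes `Δ_y = B^k(y) = s·y + [0,s)^D` of the η-lattice (η = 1/s) in lattice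
  units with the averaging weight `a_k s^{−D}` of `a_kP_k`; `unitCubes_isLowerConst`: **κ = min{8, a_k}** (the lattice constant of (2.27));
* `form_lower_unitCubes` — (2.26) + (2.27) on □: `(m² + min{8,a_k})‖φ‖²_□ ≤ ⟨φ, Hφ⟩` (= `CellData.form_lower_bound` for this data), and
  `form_lower_unitCubes_printed` — the same WITH THE PRINTED CONSTANT `min{π², a_k}` for `a_k ≤ 8`;
* **`ineq228_unitCubes`** — (2.28) on □ for every `a_k > 0`, `m² ≥ 0`, every `s ≥ 1`, `D`, `Y`: `0 < G`, `G ≤ (m² + min{8,a_k})⁻¹I`,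
  `‖Gf‖ ≤ (m² + min{8,a_k})⁻¹‖f‖`; **`ineq228_unitCubes_printed`** — (2.28) WITH THE PRINTED CONSTANT `c₀⁻¹ = min{π², a_k}` in print's
  regime `0 < a_k ≤ 8` (`c0inv_printed_le`: `(m² + min{8,a_k})⁻¹ ≤ (min{π²,a_k})⁻¹`, by `B4.display227_moot` and `m² ≥ 0`).

DICTIONARY / HONEST SCOPE.  (i) A = 0 only — print's own reduction of (2.25) to A₀ = 0 precedes the displays; the gauge reduction itself and
`A ≠ 0` ((2.23)–(2.26), Kato) are NOT touched here (rows B4.Lem2.1 / B4.Eq2.25 hold them).  (ii) Inner product `⟨f,g⟩_□ = Σ_{x∈□} conj f(x)·g(x)`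
(counting measure): print's `η^d`-weighted product multiplies both sides of every inequality here by `η^d`, so the operator inequalities and
c₀ are unchanged.  (iii) `c₀⁻¹ = m_k² + min{8, a_k} ≥ min{π², a_k}` in print's regime — the mass only sharpens; print drops it.  (iv) The
cells of `CellData` may have any sides; print's □ is the instance `unitCubes` (all sides s); the two-scale instance of p. 588 is
`B4TwoScaleForm.tsData`.  Value = the literal operator-order reading of (2.28) as kernel theorems over the tree's dictionary; NOT summit
progress.

VERSION LOG.  v1.0 = p365236 (ACCEPTED 0cc6ddf447bd, 2026-08-23).  v1.1 (this file; APPEND-ONLY, every v1.0 declaration byte-identical): + §6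
`ineq226bis_unitCubes` — **(2.26bis) AS PRINTED** on □ = ⋃_{y∈Y} B^k(y): `Σ_{Δ⊂□} ⟨φ,(−Δ^{η,N}_Δ + a_kP_k)φ⟩ ≤ ⟨φ,(−Δ^{η,N}_□ + m_k² + a_kP_k)φ⟩` for
every `φ`, every real `a_k` and every `m_k² ≥ 0` (the inter-cube bonds and the mass are dropped: `B4TwoScaleForm.sum_gradS_le` + `0 ≤ m²‖φ‖²`), and
`ineq226bis_227_unitCubes` — print's two-step chain (2.26bis) then (2.27) cube by cube, ending in `min{8,a_k}·‖φ‖²_□ ≤ ⟨φ,Hφ⟩`.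
-/

namespace Literature.MathematicalPhysics.QuantumFieldTheory.Balaban1983to89.B4Ineq228OperatorOrder

open Complex ComplexConjugate
open Literature.MathematicalPhysics.QuantumFieldTheory.Balaban1983to89.B4TwoScaleForm
open Literature.MathematicalPhysics.QuantumFieldTheory.Balaban1983to89.B4TwoScaleForm.CellData (ext0 ext0_apply opHBox_apply)

noncomputable section

variable {ι : Type*} {D : ℕ}

/-- `s ≥ 1 ⟹ s² > 0` (the gradient weight `s² = η⁻²` of (1.3) is positive). [cite: Balaban1983RegularityDecay, (1.3) p.572; dictionary] -/
theorem sq_pos_of_one_le {s : ℕ} (hs : 1 ≤ s) : (0 : ℝ) < (s : ℝ) ^ 2 := by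
  have h : (0 : ℝ) < s := by exact_mod_cast hs
  positivity

/-! ### §1 The counting inner product on the functions on a finite region and its bridge to `CellData` -/

/-- `⟨f, g⟩_S := Σ_{z∈S} conj f(z)·g(z)` on the functions on a finite `S ⊂ ℤ^D` (counting measure; print's `η^d`-weight is a common
positive factor). [cite: Balaban1983RegularityDecay, p.572 (the `L²` scalar product), (2.28) p.580; dictionary] -/
def ipS (S : Finset (Fin D → ℤ)) (f g : S → ℂ) : ℂ := ∑ z : S, conj (f z) * g z

/-- `‖f‖²_S := Σ_{z∈S} |f(z)|²` (the square of print's `‖f‖₂` on □, counting measure). [cite: Balaban1983RegularityDecay, (2.28) p.580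
(`‖·‖₂`); dictionary] -/
def nsq (S : Finset (Fin D → ℤ)) (f : S → ℂ) : ℝ := ∑ z : S, ‖f z‖ ^ 2

/-- `‖f‖²_S ≥ 0`. [cite: Balaban1983RegularityDecay, (2.28) p.580 (`‖·‖₂`); dictionary] -/
theorem nsq_nonneg (S : Finset (Fin D → ℤ)) (f : S → ℂ) : 0 ≤ nsq S f :=
  Finset.sum_nonneg fun _ _ => by positivity

/-- `‖f‖²_S = 0 ↔ f = 0`. [cite: Balaban1983RegularityDecay, (2.28) p.580 (`‖·‖₂`); dictionary] -/
theorem nsq_eq_zero_iff (S : Finset (Fin D → ℤ)) (f : S → ℂ) : nsq S f = 0 ↔ f = 0 := by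
  constructor
  · intro h
    unfold nsq at h
    rw [Finset.sum_eq_zero_iff_of_nonneg fun _ _ => by positivity] at h
    funext z
    have hz := h z (Finset.mem_univ z)
    rwa [sq_eq_zero_iff, norm_eq_zero] at hz
  · rintro rfl
    simp [nsq]

/-- `⟨f, f⟩_S = ‖f‖²_S`. [cite: Balaban1983RegularityDecay, (2.28) p.580 (`‖·‖₂`, `⟨·,·⟩`); dictionary] -/
theorem ipS_self (S : Finset (Fin D → ℤ)) (f : S → ℂ) : ipS S f f = ((nsq S f : ℝ) : ℂ) := by
  unfold ipS nsq
  push_cast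
  exact Finset.sum_congr rfl fun z _ => Complex.conj_mul' (f z)

/-- Hermitian symmetry: `conj ⟨f, g⟩_S = ⟨g, f⟩_S`. [cite: Balaban1983RegularityDecay, (2.28) p.580 (`⟨·,·⟩`); dictionary] -/
theorem conj_ipS (S : Finset (Fin D → ℤ)) (f g : S → ℂ) : conj (ipS S f g) = ipS S g f := by
  unfold ipS
  rw [map_sum]
  exact Finset.sum_congr rfl fun z _ => by rw [map_mul, Complex.conj_conj, mul_comm]

/-- Cauchy–Schwarz: `|⟨f, g⟩_S| ≤ ‖f‖_S·‖g‖_S` (the step «hence ‖G_k(□,0)f‖₂ ≦ c₀‖f‖₂»). [cite: Balaban1983RegularityDecay, (2.28) p.580;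
step supplied] -/
theorem norm_ipS_le (S : Finset (Fin D → ℤ)) (f g : S → ℂ) :
    ‖ipS S f g‖ ≤ Real.sqrt (nsq S f) * Real.sqrt (nsq S g) := by
  unfold ipS nsq
  calc ‖∑ z : S, conj (f z) * g z‖ ≤ ∑ z : S, ‖conj (f z) * g z‖ := norm_sum_le _ _
    _ = ∑ z : S, ‖f z‖ * ‖g z‖ := Finset.sum_congr rfl fun z _ => by rw [norm_mul, Complex.norm_conj]
    _ ≤ _ := Real.sum_mul_le_sqrt_mul_sqrt _ _ _

/-- the extension by zero has the same square norm: `Σ_{z∈S}|ext0 f(z)|² = ‖f‖²_S`. [folklore] -/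
private theorem sum_normSq_ext0 (S : Finset (Fin D → ℤ)) (f : S → ℂ) : ∑ z ∈ S, ‖ext0 S f z‖ ^ 2 = nsq S f := by
  unfold nsq
  rw [← Finset.sum_coe_sort S]
  exact Finset.sum_congr rfl fun z _ => by rw [ext0_apply]

/-- the `CellData` mass of the extension by zero is `‖f‖²_□`. [folklore] -/
private theorem mass_ext0 (C : CellData ι D) (f : C.S → ℂ) : C.mass (ext0 C.S f) = nsq C.S f :=
  sum_normSq_ext0 C.S f

/-- **THE ENERGY OF `H` ON THE FUNCTIONS ON □**: `⟨g, Hg⟩_□ = Φ(ext0 g)` (real), the tree's `CellData.energy_identity` read on `opHBox`.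
[cite: Balaban1983RegularityDecay, (1.3)–(1.6) p.572, (2.26)–(2.27) p.580; dictionary] -/
theorem ipS_opHBox (C : CellData ι D) (s2 m2 : ℝ) (g : C.S → ℂ) :
    ipS C.S g (C.opHBox s2 m2 g) = ((C.form s2 m2 (ext0 C.S g) : ℝ) : ℂ) := by
  unfold ipS
  have h : ∀ z : C.S, conj (g z) * C.opHBox s2 m2 g z = conj (ext0 C.S g z.1) * C.opH s2 m2 (ext0 C.S g) z.1 :=
    fun z => by rw [opHBox_apply, ext0_apply]
  rw [← C.energy_identity s2 m2 (ext0 C.S g), ← Finset.sum_coe_sort C.S]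
  exact Finset.sum_congr rfl fun z _ => h z

/-- `⟨g, Hg⟩_□` is real (`H` symmetric: «quadratic form considerations»). [cite: Balaban1983RegularityDecay, (2.26)–(2.27) p.580; dictionary] -/
theorem ipS_opHBox_im (C : CellData ι D) (s2 m2 : ℝ) (g : C.S → ℂ) : (ipS C.S g (C.opHBox s2 m2 g)).im = 0 := by
  rw [ipS_opHBox, Complex.ofReal_im]

/-- **(2.26)–(2.27) FOR `H` ON □**: `(m² + κ)·‖g‖²_□ ≤ ⟨g, Hg⟩_□` for every lower constant `κ` of the cell data (= the tree's
`CellData.form_lower_bound`). [cite: Balaban1983RegularityDecay, (2.26)–(2.27) p.580; repaired constants] -/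
theorem ipS_opHBox_re_ge (C : CellData ι D) {s2 : ℝ} (hs : 0 < s2) (m2 : ℝ) {κ : ℝ} (hκ : C.IsLowerConst s2 κ)
    (g : C.S → ℂ) : (m2 + κ) * nsq C.S g ≤ (ipS C.S g (C.opHBox s2 m2 g)).re := by
  rw [ipS_opHBox, Complex.ofReal_re, ← mass_ext0]
  exact C.form_lower_bound hs m2 hκ _

/-! ### §2 The Green operator `G_k(□,0) = H⁻¹` -/

/-- **THE GREEN OPERATOR `G_k(□,0) := (−Δ^{η,N}_□ + m_k² + a_kP_k)⁻¹`** (A = 0) on the functions on □, as a `ℂ`-linear equivalence: the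
inverse of the bijection `H = opHBox` (`m² + κ > 0`). [cite: Balaban1983RegularityDecay, (1.6) p.572, (2.28) p.580; dictionary (A = 0,
lattice units)] -/
def green (C : CellData ι D) {s2 : ℝ} (hs : 0 < s2) (m2 : ℝ) {κ : ℝ} (hκ : C.IsLowerConst s2 κ) (hmk : 0 < m2 + κ) :
    (C.S → ℂ) ≃ₗ[ℂ] (C.S → ℂ) :=
  (LinearEquiv.ofBijective (C.opHBox s2 m2) (C.opHBox_bijective hs m2 hκ hmk)).symm

/-- `H(Gf) = f`: `G_k(□,0) = (−Δ^{η,N}_□ + m_k² + a_kP_k)⁻¹`. [cite: Balaban1983RegularityDecay, (1.6) p.572, (2.28) p.580; dictionary] -/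
theorem opHBox_green (C : CellData ι D) {s2 : ℝ} (hs : 0 < s2) (m2 : ℝ) {κ : ℝ} (hκ : C.IsLowerConst s2 κ)
    (hmk : 0 < m2 + κ) (f : C.S → ℂ) : C.opHBox s2 m2 (green C hs m2 hκ hmk f) = f :=
  (LinearEquiv.ofBijective (C.opHBox s2 m2) (C.opHBox_bijective hs m2 hκ hmk)).apply_symm_apply f

/-- `G(Hg) = g`. [cite: Balaban1983RegularityDecay, (1.6) p.572, (2.28) p.580; dictionary] -/
theorem green_opHBox (C : CellData ι D) {s2 : ℝ} (hs : 0 < s2) (m2 : ℝ) {κ : ℝ} (hκ : C.IsLowerConst s2 κ)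
    (hmk : 0 < m2 + κ) (g : C.S → ℂ) : green C hs m2 hκ hmk (C.opHBox s2 m2 g) = g :=
  (LinearEquiv.ofBijective (C.opHBox s2 m2) (C.opHBox_bijective hs m2 hκ hmk)).symm_apply_apply g

/-- `G f` is THE solution of `Hg = f` on □. [cite: Balaban1983RegularityDecay, (1.6) p.572, (2.28) p.580; dictionary] -/
theorem green_unique (C : CellData ι D) {s2 : ℝ} (hs : 0 < s2) (m2 : ℝ) {κ : ℝ} (hκ : C.IsLowerConst s2 κ)
    (hmk : 0 < m2 + κ) {f g : C.S → ℂ} (h : C.opHBox s2 m2 g = f) : g = green C hs m2 hκ hmk f := by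
  rw [← h, green_opHBox]

/-- `⟨f, Gf⟩_□ = ⟨HGf, Gf⟩_□ = Φ(ext0 (Gf))`: the quadratic form of `G` is the energy of `Gf`. [cite: Balaban1983RegularityDecay, (2.28)
p.580; dictionary] -/
theorem ipS_green (C : CellData ι D) {s2 : ℝ} (hs : 0 < s2) (m2 : ℝ) {κ : ℝ} (hκ : C.IsLowerConst s2 κ)
    (hmk : 0 < m2 + κ) (f : C.S → ℂ) :
    ipS C.S f (green C hs m2 hκ hmk f) = ((C.form s2 m2 (ext0 C.S (green C hs m2 hκ hmk f)) : ℝ) : ℂ) := by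
  set g := green C hs m2 hκ hmk f with hg
  calc ipS C.S f g = ipS C.S (C.opHBox s2 m2 g) g := by rw [hg, opHBox_green]
    _ = conj (ipS C.S g (C.opHBox s2 m2 g)) := (conj_ipS C.S g _).symm
    _ = _ := by rw [ipS_opHBox, Complex.conj_ofReal]

/-- **`G` IS HERMITIAN**: `⟨f, Gf⟩_□` is real for every `f` — so «0 < G ≦ c₀I» is a statement about real quadratic forms.
[cite: Balaban1983RegularityDecay, (2.28) p.580] -/
theorem ipS_green_im (C : CellData ι D) {s2 : ℝ} (hs : 0 < s2) (m2 : ℝ) {κ : ℝ} (hκ : C.IsLowerConst s2 κ)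
    (hmk : 0 < m2 + κ) (f : C.S → ℂ) : (ipS C.S f (green C hs m2 hκ hmk f)).im = 0 := by
  rw [ipS_green, Complex.ofReal_im]

/-- the real part of `⟨f, Gf⟩_□` is the energy `Φ(ext0 (Gf))`. [cite: Balaban1983RegularityDecay, (2.28) p.580; dictionary] -/
theorem ipS_green_re (C : CellData ι D) {s2 : ℝ} (hs : 0 < s2) (m2 : ℝ) {κ : ℝ} (hκ : C.IsLowerConst s2 κ)
    (hmk : 0 < m2 + κ) (f : C.S → ℂ) :
    (ipS C.S f (green C hs m2 hκ hmk f)).re = C.form s2 m2 (ext0 C.S (green C hs m2 hκ hmk f)) := by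
  rw [ipS_green, Complex.ofReal_re]

/-! ### §3 «0 < G_k(□,0) ≦ c₀I» and «‖G_k(□,0)f‖₂ ≦ c₀‖f‖₂», c₀⁻¹ = m² + κ -/

/-- **«0 < G_k(□,0)», QUANTITATIVELY**: `(m² + κ)·‖Gf‖²_□ ≤ ⟨f, Gf⟩_□`. [cite: Balaban1983RegularityDecay, (2.28) p.580; repaired
constants] -/
theorem green_form_lower (C : CellData ι D) {s2 : ℝ} (hs : 0 < s2) (m2 : ℝ) {κ : ℝ} (hκ : C.IsLowerConst s2 κ)
    (hmk : 0 < m2 + κ) (f : C.S → ℂ) :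
    (m2 + κ) * nsq C.S (green C hs m2 hκ hmk f) ≤ (ipS C.S f (green C hs m2 hκ hmk f)).re := by
  rw [ipS_green_re, ← mass_ext0]
  exact C.form_lower_bound hs m2 hκ _

/-- `⟨f, Gf⟩_□ ≥ 0` («0 < G_k(□,0)», weak form). [cite: Balaban1983RegularityDecay, (2.28) p.580] -/
theorem green_form_nonneg (C : CellData ι D) {s2 : ℝ} (hs : 0 < s2) (m2 : ℝ) {κ : ℝ} (hκ : C.IsLowerConst s2 κ)
    (hmk : 0 < m2 + κ) (f : C.S → ℂ) : 0 ≤ (ipS C.S f (green C hs m2 hκ hmk f)).re :=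
  (mul_nonneg hmk.le (nsq_nonneg _ _)).trans (green_form_lower C hs m2 hκ hmk f)

/-- **«0 < G_k(□,0)»**: `⟨f, Gf⟩_□ > 0` for every `f ≠ 0` on □. [cite: Balaban1983RegularityDecay, (2.28) p.580] -/
theorem green_pos (C : CellData ι D) {s2 : ℝ} (hs : 0 < s2) (m2 : ℝ) {κ : ℝ} (hκ : C.IsLowerConst s2 κ)
    (hmk : 0 < m2 + κ) {f : C.S → ℂ} (hf : f ≠ 0) : 0 < (ipS C.S f (green C hs m2 hκ hmk f)).re := by
  have hg : green C hs m2 hκ hmk f ≠ 0 := fun h => hf (by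
    have := congrArg (C.opHBox s2 m2) h
    rwa [opHBox_green, map_zero] at this)
  have hn : 0 < nsq C.S (green C hs m2 hκ hmk f) :=
    (nsq_nonneg _ _).lt_of_ne fun h => hg ((nsq_eq_zero_iff _ _).1 h.symm)
  exact (mul_pos hmk hn).trans_le (green_form_lower C hs m2 hκ hmk f)

/-- **«G_k(□,0) ≦ c₀I», c₀⁻¹ = m² + κ**: `⟨f, Gf⟩_□ ≤ (m² + κ)⁻¹·‖f‖²_□` (from `(m²+κ)‖Gf‖² ≤ ⟨f,Gf⟩ ≤ ‖f‖·‖Gf‖`).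
[cite: Balaban1983RegularityDecay, (2.28) p.580; repaired constants] -/
theorem green_form_upper (C : CellData ι D) {s2 : ℝ} (hs : 0 < s2) (m2 : ℝ) {κ : ℝ} (hκ : C.IsLowerConst s2 κ)
    (hmk : 0 < m2 + κ) (f : C.S → ℂ) :
    (ipS C.S f (green C hs m2 hκ hmk f)).re ≤ (m2 + κ)⁻¹ * nsq C.S f := by
  set g := green C hs m2 hκ hmk f with hg
  set E := (ipS C.S f g).re with hE
  have h1 : (m2 + κ) * nsq C.S g ≤ E := green_form_lower C hs m2 hκ hmk f
  have h2 : E ≤ Real.sqrt (nsq C.S f) * Real.sqrt (nsq C.S g) :=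
    (Complex.re_le_norm _).trans (norm_ipS_le C.S f g)
  have hE0 : 0 ≤ E := green_form_nonneg C hs m2 hκ hmk f
  have hF0 := nsq_nonneg C.S f
  rcases hE0.eq_or_lt with h0 | hpos
  · rw [← h0]; exact mul_nonneg (inv_nonneg.mpr hmk.le) hF0
  · have h3 : E ^ 2 ≤ nsq C.S f * nsq C.S g := by
      calc E ^ 2 ≤ (Real.sqrt (nsq C.S f) * Real.sqrt (nsq C.S g)) ^ 2 := pow_le_pow_left₀ hE0 h2 2
        _ = nsq C.S f * nsq C.S g := by rw [mul_pow, Real.sq_sqrt hF0, Real.sq_sqrt (nsq_nonneg _ _)]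
    have h4 : nsq C.S g ≤ (m2 + κ)⁻¹ * E := by
      rw [← div_eq_inv_mul, le_div_iff₀ hmk, mul_comm]; exact h1
    have h5 : E * E ≤ ((m2 + κ)⁻¹ * nsq C.S f) * E := by
      calc E * E = E ^ 2 := (sq E).symm
        _ ≤ nsq C.S f * nsq C.S g := h3
        _ ≤ nsq C.S f * ((m2 + κ)⁻¹ * E) := mul_le_mul_of_nonneg_left h4 hF0
        _ = ((m2 + κ)⁻¹ * nsq C.S f) * E := by ring
    exact le_of_mul_le_mul_right h5 hpos

/-- **«hence ‖G_k(□,0)f‖₂ ≦ c₀‖f‖₂»**: `(m² + κ)·‖Gf‖_□ ≤ ‖f‖_□` (the tree's `CellData.green_norm_le` for the solution `Gf` of `Hg = f`).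
[cite: Balaban1983RegularityDecay, (2.28) p.580; repaired constants] -/
theorem green_norm_le' (C : CellData ι D) {s2 : ℝ} (hs : 0 < s2) (m2 : ℝ) {κ : ℝ} (hκ : C.IsLowerConst s2 κ)
    (hmk : 0 < m2 + κ) (f : C.S → ℂ) :
    (m2 + κ) * Real.sqrt (nsq C.S (green C hs m2 hκ hmk f)) ≤ Real.sqrt (nsq C.S f) := by
  have hsol : ∀ z ∈ C.S, C.opH s2 m2 (ext0 C.S (green C hs m2 hκ hmk f)) z = ext0 C.S f z := fun z hz => by
    have h := congrFun (opHBox_green C hs m2 hκ hmk f) ⟨z, hz⟩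
    rw [opHBox_apply] at h
    rw [h]
    exact (ext0_apply C.S f ⟨z, hz⟩).symm
  have h := C.green_norm_le hs m2 hκ (ext0 C.S f) (ext0 C.S (green C hs m2 hκ hmk f)) hsol
  rwa [mass_ext0, sum_normSq_ext0] at h

/-- the same as `‖Gf‖_□ ≤ c₀‖f‖_□`, `c₀ = (m² + κ)⁻¹`. [cite: Balaban1983RegularityDecay, (2.28) p.580; repaired constants] -/
theorem green_norm_bound (C : CellData ι D) {s2 : ℝ} (hs : 0 < s2) (m2 : ℝ) {κ : ℝ} (hκ : C.IsLowerConst s2 κ)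
    (hmk : 0 < m2 + κ) (f : C.S → ℂ) :
    Real.sqrt (nsq C.S (green C hs m2 hκ hmk f)) ≤ (m2 + κ)⁻¹ * Real.sqrt (nsq C.S f) := by
  rw [← div_eq_inv_mul, le_div_iff₀ hmk, mul_comm]
  exact green_norm_le' C hs m2 hκ hmk f

/-! ### §4 Print's □: a finite union of unit cubes of the η-lattice, η = 1/s — the constant κ = min{8, a_k} -/

/-- **PRINT'S □ = «a sum of unit cubes Δ»** in lattice units: the unit cubes `Δ_y = B^k(y) = s·y + [0,s)^D`, `y ∈ Y ⊂ ℤ^D` (a finite set of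
unit-lattice points), each carrying the weight `a_k s^{−D}` of `a_kP_k` (p.572 (1.4)–(1.5): `(Q_kφ)(y) = Σ_{x∈B^k(y)} η^dφ(x)`), gradient
weight `s² = η⁻²`. [cite: Balaban1983RegularityDecay, (1.4)–(1.6) p.572, (2.26) p.580 («□ is a sum of unit cubes Δ»); dictionary] -/
def unitCubes (s : ℕ) (hs : 1 ≤ s) (Y : Finset (Fin D → ℤ)) (a : ℝ) : CellData (Fin D → ℤ) D where
  I := Y
  cor y ν := (s : ℤ) * y ν
  N _ := s
  w _ := a * ((s : ℝ) ^ D)⁻¹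
  one_le_N _ _ := hs
  disj _ _ _ _ hne := ablock_disjoint hs hne

/-- the cells of `unitCubes` are the aligned blocks `B^k(y)`. [cite: Balaban1983RegularityDecay, (1.4) p.572 (blocks `B^k(y)`); dictionary] -/
theorem unitCubes_c (s : ℕ) (hs : 1 ≤ s) (Y : Finset (Fin D → ℤ)) (a : ℝ) : (unitCubes s hs Y a).c = ablock s := rfl

/-- the region of `unitCubes` is `□ = ⋃_{y∈Y} B^k(y)` («□ is a sum of unit cubes Δ»). [cite: Balaban1983RegularityDecay, (2.26) p.580;
dictionary] -/
theorem unitCubes_S (s : ℕ) (hs : 1 ≤ s) (Y : Finset (Fin D → ℤ)) (a : ℝ) :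
    (unitCubes s hs Y a).S = Y.biUnion (ablock s) := rfl

/-- **THE LATTICE CONSTANT OF (2.27) ON UNIT CUBES**: `κ = min{8, a_k}` is a lower constant of `unitCubes` (one cell: `min{8·s²/s²,
a_k s^{−D}·s^D} = min{8, a_k}`; the `8` is `B4Block227.block227`'s, print's `π²` being the continuum value — census G-B4-03).
[cite: Balaban1983RegularityDecay, (2.27) p.580; repaired constant] -/
theorem unitCubes_isLowerConst (s : ℕ) (hs : 1 ≤ s) (Y : Finset (Fin D → ℤ)) (a : ℝ) :
    (unitCubes s hs Y a).IsLowerConst ((s : ℝ) ^ 2) (min 8 a) := by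
  intro y _
  show min 8 a ≤ min (8 * (s : ℝ) ^ 2 / (s : ℝ) ^ 2) (a * ((s : ℝ) ^ D)⁻¹ * (s : ℝ) ^ D)
  have hs0 : (0 : ℝ) < s := by exact_mod_cast hs
  have e1 : 8 * (s : ℝ) ^ 2 / (s : ℝ) ^ 2 = 8 := by field_simp
  have e2 : a * ((s : ℝ) ^ D)⁻¹ * (s : ℝ) ^ D = a := by field_simp
  rw [e1, e2]

/-- **(2.26) + (2.27) ON □ = ⋃ Δ** (lattice constant): `(m² + min{8, a_k})·Σ_□|φ|² ≤ ⟨φ, (−Δ^{η,N}_□ + m² + a_kP_k)φ⟩` for every `φ`,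
every real `a_k`, `m²`. [cite: Balaban1983RegularityDecay, (2.26)–(2.27) p.580; repaired constant] -/
theorem form_lower_unitCubes (s : ℕ) (hs : 1 ≤ s) (Y : Finset (Fin D → ℤ)) (a m2 : ℝ) (φ : (Fin D → ℤ) → ℂ) :
    (m2 + min 8 a) * (unitCubes s hs Y a).mass φ ≤ (unitCubes s hs Y a).form ((s : ℝ) ^ 2) m2 φ :=
  (unitCubes s hs Y a).form_lower_bound (sq_pos_of_one_le hs) m2 (unitCubes_isLowerConst s hs Y a) φ

/-- **(2.26) + (2.27) ON □ WITH THE PRINTED CONSTANT `min{π², a_k}`**, in print's regime `a_k ≤ 8` («a is a positive constant close to 1»,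
`a_k ≤ a`), where `min{π², a_k} = min{8, a_k} = a_k` (`B4.display227_moot`). [cite: Balaban1983RegularityDecay, (2.26)–(2.27) p.580] -/
theorem form_lower_unitCubes_printed (s : ℕ) (hs : 1 ≤ s) (Y : Finset (Fin D → ℤ)) {a : ℝ} (ha8 : a ≤ 8) (m2 : ℝ)
    (φ : (Fin D → ℤ) → ℂ) :
    (m2 + min (Real.pi ^ 2) a) * (unitCubes s hs Y a).mass φ ≤ (unitCubes s hs Y a).form ((s : ℝ) ^ 2) m2 φ := by
  have e : min (Real.pi ^ 2) a = min 8 a := (B4.display227_moot a ha8).1.trans (B4.display227_moot a ha8).2.symm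
  rw [e]
  exact form_lower_unitCubes s hs Y a m2 φ

/-! ### §5 (2.28) on □ -/

/-- positivity of `c₀⁻¹ = m² + min{8, a_k}` for `a_k > 0`, `m² ≥ 0` (print's c₀ is «positive»). [cite: Balaban1983RegularityDecay, (2.28)
p.580; repaired constant] -/
theorem c0inv_pos {a m2 : ℝ} (ha : 0 < a) (hm : 0 ≤ m2) : 0 < m2 + min 8 a :=
  add_pos_of_nonneg_of_pos hm (lt_min (by norm_num) ha)

/-- **THE PRINTED CONSTANT DOMINATES**: in print's regime `0 < a_k ≤ 8`, `m² ≥ 0`, `(m² + min{8, a_k})⁻¹ ≤ (min{π², a_k})⁻¹ = c₀` — the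
lattice constant and the mass only sharpen (2.28). [cite: Balaban1983RegularityDecay, (2.28) p.580] -/
theorem c0inv_printed_le {a m2 : ℝ} (ha : 0 < a) (ha8 : a ≤ 8) (hm : 0 ≤ m2) :
    (m2 + min 8 a)⁻¹ ≤ (min (Real.pi ^ 2) a)⁻¹ := by
  obtain ⟨h1, h2⟩ := B4.display227_moot a ha8
  rw [h1, h2]
  exact inv_anti₀ ha (by linarith)

/-- **(2.28) ON □ = ⋃_{y∈Y} B^k(y), A = 0, LATTICE CONSTANT** — for every `a_k > 0`, `m² ≥ 0`, every `s ≥ 1`, `D`, `Y` and every `f` on □, with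
`G = G_k(□,0)` and `c₀⁻¹ = m² + min{8, a_k}`: `⟨f,Gf⟩` is real, `(c₀⁻¹)·‖Gf‖² ≤ ⟨f,Gf⟩` («0 < G»), `⟨f,Gf⟩ ≤ c₀‖f‖²` («G ≦ c₀I»),
`‖Gf‖ ≤ c₀‖f‖`. [cite: Balaban1983RegularityDecay, (2.28) p.580; repaired constant] -/
theorem ineq228_unitCubes (s : ℕ) (hs : 1 ≤ s) (Y : Finset (Fin D → ℤ)) {a m2 : ℝ} (ha : 0 < a) (hm : 0 ≤ m2)
    (f : (unitCubes s hs Y a).S → ℂ) :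
    let C := unitCubes s hs Y a
    let G := green C (sq_pos_of_one_le hs) m2 (unitCubes_isLowerConst s hs Y a) (c0inv_pos ha hm)
    (ipS C.S f (G f)).im = 0 ∧
      (m2 + min 8 a) * nsq C.S (G f) ≤ (ipS C.S f (G f)).re ∧
      (ipS C.S f (G f)).re ≤ (m2 + min 8 a)⁻¹ * nsq C.S f ∧
      Real.sqrt (nsq C.S (G f)) ≤ (m2 + min 8 a)⁻¹ * Real.sqrt (nsq C.S f) :=
  ⟨ipS_green_im _ _ _ _ _ f, green_form_lower _ _ _ _ _ f, green_form_upper _ _ _ _ _ f, green_norm_bound _ _ _ _ _ f⟩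

/-- **«0 < G_k(□,0)» ON □** (strict): `⟨f, G_k(□,0)f⟩ > 0` for `f ≠ 0`, every `a_k > 0`, `m² ≥ 0`. [cite: Balaban1983RegularityDecay, (2.28)
p.580] -/
theorem green_pos_unitCubes (s : ℕ) (hs : 1 ≤ s) (Y : Finset (Fin D → ℤ)) {a m2 : ℝ} (ha : 0 < a) (hm : 0 ≤ m2)
    {f : (unitCubes s hs Y a).S → ℂ} (hf : f ≠ 0) :
    let C := unitCubes s hs Y a
    0 < (ipS C.S f (green C (sq_pos_of_one_le hs) m2 (unitCubes_isLowerConst s hs Y a) (c0inv_pos ha hm) f)).re :=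
  green_pos _ _ _ _ _ hf

/-- **(2.28) ON □ WITH THE PRINTED CONSTANT `c₀⁻¹ = min{π², a_k}`**, in print's regime `0 < a_k ≤ 8`, `m² ≥ 0` (every `s ≥ 1`, `D`, `Y`, `f`):
`⟨f, G_k(□,0)f⟩ > 0` for `f ≠ 0` is `green_pos_unitCubes`; here «G_k(□,0) ≦ c₀I»: `⟨f,Gf⟩ ≤ (min{π²,a_k})⁻¹‖f‖²`, and «‖G_k(□,0)f‖₂ ≦
c₀‖f‖₂»: `‖Gf‖ ≤ (min{π²,a_k})⁻¹‖f‖`. [cite: Balaban1983RegularityDecay, (2.28) p.580] -/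
theorem ineq228_unitCubes_printed (s : ℕ) (hs : 1 ≤ s) (Y : Finset (Fin D → ℤ)) {a m2 : ℝ} (ha : 0 < a) (ha8 : a ≤ 8)
    (hm : 0 ≤ m2) (f : (unitCubes s hs Y a).S → ℂ) :
    let C := unitCubes s hs Y a
    let G := green C (sq_pos_of_one_le hs) m2 (unitCubes_isLowerConst s hs Y a) (c0inv_pos ha hm)
    (ipS C.S f (G f)).re ≤ (min (Real.pi ^ 2) a)⁻¹ * nsq C.S f ∧
      Real.sqrt (nsq C.S (G f)) ≤ (min (Real.pi ^ 2) a)⁻¹ * Real.sqrt (nsq C.S f) := by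
  have hc := c0inv_printed_le ha ha8 hm
  exact ⟨(green_form_upper _ _ _ _ _ f).trans (mul_le_mul_of_nonneg_right hc (nsq_nonneg _ _)),
    (green_norm_bound _ _ _ _ _ f).trans (mul_le_mul_of_nonneg_right hc (Real.sqrt_nonneg _))⟩

/-- non-vacuity: the hypotheses of `ineq228_unitCubes_printed` are met by print's own numbers (`a_k = a = 1`, `m² = 0`, `s = 2`, one cube).
[folklore] -/
example : (0 : ℝ) < 1 ∧ (1 : ℝ) ≤ 8 ∧ (0 : ℝ) ≤ 0 ∧ 1 ≤ 2 := by norm_num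

/-! ### §6 (v1.1) (2.26bis) AS PRINTED on □: the sum of the cube forms is below the form of □ -/

/-- **(2.26bis) AS PRINTED**: «□ is a sum of unit cubes Δ and we have ⟨φ,(−Δ^{η,N}_□ + m_k² + a_kP_k)φ⟩ ≧ Σ_{Δ⊂□} ⟨φ,(−Δ^{η,N}_Δ + a_kP_k)φ⟩» —
in lattice units on `unitCubes s hs Y a` (□ = ⋃_{y∈Y} B^k(y), η = 1/s): for every `φ`, every real `a_k`, every `m_k² ≥ 0`,
`Σ_{y∈Y} (s²·Σ_{bonds⊂B^k(y)}|∇φ|² + a_k s^{−D}|Σ_{B^k(y)}φ|²) ≤ s²·Σ_{bonds⊂□}|∇φ|² + m_k²·Σ_□|φ|² + Σ_{y∈Y} a_k s^{−D}|Σ_{B^k(y)}φ|²` (the bonds joining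
different cubes and the mass term are dropped). [cite: Balaban1983RegularityDecay, (2.26) p.580 (second display so numbered)] -/
theorem ineq226bis_unitCubes (s : ℕ) (hs : 1 ≤ s) (Y : Finset (Fin D → ℤ)) (a : ℝ) {m2 : ℝ} (hm : 0 ≤ m2)
    (φ : (Fin D → ℤ) → ℂ) :
    ∑ y ∈ Y, ((s : ℝ) ^ 2 * gradS (ablock s y) φ + a * ((s : ℝ) ^ D)⁻¹ * ‖∑ x ∈ ablock s y, φ x‖ ^ 2)
      ≤ (unitCubes s hs Y a).form ((s : ℝ) ^ 2) m2 φ := by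
  have hg : ∑ y ∈ Y, gradS (ablock s y) φ ≤ gradS ((unitCubes s hs Y a).S) φ :=
    sum_gradS_le Y (ablock s) (unitCubes s hs Y a).disj φ
  have hs2 : (0 : ℝ) ≤ (s : ℝ) ^ 2 := by positivity
  have hmass : 0 ≤ m2 * (unitCubes s hs Y a).mass φ :=
    mul_nonneg hm (Finset.sum_nonneg fun _ _ => by positivity)
  have havg : (unitCubes s hs Y a).avgForm φ = ∑ y ∈ Y, a * ((s : ℝ) ^ D)⁻¹ * ‖∑ x ∈ ablock s y, φ x‖ ^ 2 := rfl
  unfold CellData.form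
  rw [havg, Finset.sum_add_distrib, ← Finset.mul_sum]
  have := mul_le_mul_of_nonneg_left hg hs2
  linarith

/-- **PRINT'S CHAIN (2.26bis) ⇒ (2.27), cube by cube**: each cube form is `≥ min{8, a_k}·Σ_{B^k(y)}|φ|²` (`B4TwoScaleForm.cell_bound`, the lattice
constant of (2.27)), so `min{8,a_k}·Σ_□|φ|² ≤ Σ_{Δ⊂□} ⟨φ,(−Δ^{η,N}_Δ + a_kP_k)φ⟩ ≤ ⟨φ,(−Δ^{η,N}_□ + m_k² + a_kP_k)φ⟩` — the form half of
«from this and (2.26) we get 0 < G_k(□,0) ≦ c₀I». [cite: Balaban1983RegularityDecay, (2.26)–(2.28) p.580; repaired constant] -/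
theorem ineq226bis_227_unitCubes (s : ℕ) (hs : 1 ≤ s) (Y : Finset (Fin D → ℤ)) (a : ℝ) {m2 : ℝ} (hm : 0 ≤ m2)
    (φ : (Fin D → ℤ) → ℂ) :
    min 8 a * (unitCubes s hs Y a).mass φ
      ≤ ∑ y ∈ Y, ((s : ℝ) ^ 2 * gradS (ablock s y) φ + a * ((s : ℝ) ^ D)⁻¹ * ‖∑ x ∈ ablock s y, φ x‖ ^ 2) ∧
    ∑ y ∈ Y, ((s : ℝ) ^ 2 * gradS (ablock s y) φ + a * ((s : ℝ) ^ D)⁻¹ * ‖∑ x ∈ ablock s y, φ x‖ ^ 2)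
      ≤ (unitCubes s hs Y a).form ((s : ℝ) ^ 2) m2 φ := by
  refine ⟨?_, ineq226bis_unitCubes s hs Y a hm φ⟩
  have hcell : ∀ y ∈ Y, min 8 a * ∑ x ∈ ablock s y, ‖φ x‖ ^ 2
      ≤ (s : ℝ) ^ 2 * gradS (ablock s y) φ + a * ((s : ℝ) ^ D)⁻¹ * ‖∑ x ∈ ablock s y, φ x‖ ^ 2 := fun y hy => by
    have hκ := unitCubes_isLowerConst s hs Y a y hy
    have hb := cell_bound (sq_pos_of_one_le hs) (a * ((s : ℝ) ^ D)⁻¹) (fun ν => (s : ℤ) * y ν) hs φ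
    exact (mul_le_mul_of_nonneg_right hκ (Finset.sum_nonneg fun _ _ => by positivity)).trans hb
  have hsum := Finset.sum_le_sum hcell
  rw [← Finset.mul_sum] at hsum
  have hmass : (unitCubes s hs Y a).mass φ = ∑ y ∈ Y, ∑ x ∈ ablock s y, ‖φ x‖ ^ 2 :=
    (unitCubes s hs Y a).mass_eq_sum φ
  rw [hmass]
  exact hsum

end

end Literature.MathematicalPhysics.QuantumFieldTheory.Balaban1983to89.B4Ineq228OperatorOrder
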